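/-
Copyright: lit-balaban cell, Phase-2 proof seat p11 (gen 2).  Statement-level skeleton of a published paper; no proof claims beyond
what the kernel checks below.
-/
import Literature.MathematicalPhysics.QuantumFieldTheory.BalabanImbrieJaffe1984to88.BIJ85Eq461Proof
import Literature.MathematicalPhysics.QuantumFieldTheory.BalabanImbrieJaffe1984to88.BIJ85Sect4Statements

/-!
# `BalabanImbrieJaffe1984to88.BIJ85ScalarForm464` — T. Bałaban, J. Imbrie, A. Jaffe, *Renormalization of the Higgs model:
minimizers, propagators and the stability of mean field theory*, Commun. Math. Phys. **97** (1985) 299–329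
[BalabanImbrieJaffe1985]: Sect. 3 p. 308 **(3.24)–(3.28)** (the scalar quadratic form of the first step, its minimizer φ_cl and the
background/fluctuation expansion) and Sect. 4.6 p. 313 **(4.6.4)** *"The quadratic form which arises for the scalar field is
⟨ψ, Δ_k(u_k)ψ⟩"* with the η-lattice minimizer **ψ_k = a_kG_k(u_k)Q_k^*(u_k)ψ** — TYPED with bodies and PROVED over the
finite-dimensional setting of seat p30's `BIJ85Eq461Proof` ((4.6.1)–(4.6.3)); the printed sign of (3.27) DECIDED (refuted as
printed, the repaired sign is the one printed on p. 313)

statement-level skeleton of published theorems with citation tags; proofs where landed; nothing here is a claim about the Yang–Mills mass gap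

PDF held: `paper:balaban1985-cmp97-bij-higgs-minimizers` (journal page = PDF page + 298).  Pages read as images: p. 308 [PDF 10]
(`run/shared/lean/pub/lit-balaban/lit-balaban-r15/pages/1985-cmp97-bij-higgs-minimizers-p010-x2.png`) and p. 313 [PDF 15]
(`run/shared/lean/pub/lit-balaban/lit-balaban-p08/renders/bij85-p015.png`).

CITATION HEADER (lean-in-tree rule).  Phase-2 file of the lit-balaban TYPED SKELETON (HOME `run/shared/lean/pub/lit-balaban/`),
rows **C1.Eq3.24-3.28** (status `typed p239474`: *"(3.24)–(3.25), (3.27) themselves not typed"*) and **C1.Eq4.6.2-4.6.4** (status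
`typed p239474`: r15's ring-level `BIJ85Sect4Statements.aK`/`deltaScalar`), seat p11 gen 2 (unit `lit-balaban-p11-g2`), TAKING
line HOME/STATUS.md 2026-08-21T04:24:51Z; owner r15, referee ref-5.

THE PRINTED TEXT, verbatim.  p. 308: *"Let us now direct attention to the boson part of the integral (3.1). We expand S(u,φ) +
½a‖ψ − Q(u)φ‖² (3.24) to identify the quadratic terms in φ. Using (3.23), we also expand u about its background value u₁, yielding
additional contributions from A which are accompanied by (small) factors O(e(ε)). Thus the leading terms in the Higgs action are
½a‖Q(u^{(1)})φ − ψ‖² + ½⟨φ, Δ_{u^{(1)}}φ⟩, (3.25) with all corrections included in the potential V₁(A,φ,f₁) which have coefficients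
O(ε). Define G = (−Δ_{u^{(1)}} + aQ(u^{(1)})^*Q(u^{(1)}))^{−1}. (3.26) The quadratic form (3.25) is minimized by φ_cl = −aGQ(u′)^*ψ.
(3.27) See Appendix A. Writing φ = φ_cl + φ_fl, expand (3.24) into background and fluctuation parts, yielding ½⟨φ_fl, G^{−1}φ_fl⟩ +
½a⟨ψ, [I − aQGQ^*]ψ⟩. (3.28)"*.  p. 313: *"Since no restrictions on φ occur in the Gaussian integral (4.6.1), we can also write
G_k(u_k) = [−Δ_{u_k} + a_kQ_k^*(u_k)Q_k(u_k)]^{−1}, (4.6.2) where −Δ_{u_k} = D^*_{u_k}D_{u_k}. (4.6.3) … The quadratic form which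
arises for the scalar field is ⟨ψ, Δ_k(u_k)ψ⟩, where ψ is the unit lattice scalar field and where Δ_k(u_k) = a_kI −
a_k²Q_k(u_k)G_k(u_k)Q_k^*(u_k). (4.6.4) The scalar field action depends on the unit lattice field ψ through the η-lattice minimizer
ψ_k, where ψ_k = a_kG_k(u_k)Q_k^*(u_k)ψ."*

THE TYPING (as in `BIJ85Eq461Proof`, whose hypotheses and notation are kept): the η-lattice scalar fields φ, the values of the
covariant derivative D_u and the unit-lattice (block) scalar fields ψ are three finite-dimensional real inner product spaces `Φ`, `Ψ`,
`Φ₁`; D_u = a linear `D : Φ → Ψ` (so that `‖Dφ‖² = ⟨φ, (−Δ_u)φ⟩`, (4.6.3)), Q(u) = a linear `Q : Φ → Φ₁`, `a` real (= a at k = 1,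
(3.25); = a_k = `BIJ85Sect4Statements.aK a L k` at step k, (4.6.4)); `G` = any right inverse of `T = D^*D + aQ^*Q` (hypothesis
`hG`, = (3.26)/(4.6.2), existence under p30's positivity condition `hpos` is `BIJ85Eq461Proof.exists_inverse`).  READING NOTE on
(3.25): the print writes the kinetic term as *"+½⟨φ, Δ_{u^{(1)}}φ⟩"* while (3.26) and (4.6.3) use *"−Δ_u = D^*_uD_u"*; the form is
typed as the non-negative `½‖D_uφ‖²` (= ½⟨φ, (−Δ_u)φ⟩ in the (4.6.3) convention), the only reading under which (3.26)–(3.28)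
hold (HOME/GAPS.md).  WHAT IS PROVED: `scalarForm_eq` (the form (3.25) = ½⟨φ,Tφ⟩ − a⟨φ,Q^*ψ⟩ + ½a‖ψ‖²), `opT_phiCl`
(Tφ_cl = aQ^*ψ), **`eq328`** ((3.28) EXACTLY: the form at φ_cl + φ_fl is ½⟨φ_fl, G^{−1}φ_fl⟩ + ½a⟨ψ,[I − aQGQ^*]ψ⟩), `scalarForm_phiCl`
(its value at φ_cl is ½⟨ψ, Δψ⟩ with Δ = aI − a²QGQ^* of (4.6.4), `deltaOp`, = r15's `deltaScalar` in `End Φ₁`: `deltaOp_eq_deltaScalar`),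
**`isMinOn_phiCl`** (φ_cl = +aGQ^*ψ MINIMIZES the form, a ≥ 0 — the sentence of (3.27) with the sign of p. 313; uniqueness
`eq_phiCl_of_isMinOn` under `hpos`), **`eq327_asPrinted_refuted`** (kernel witness: with Φ = Ψ = Φ₁ = ℝ, D = 0, Q = I, a = 1, ψ = 1
the printed φ_cl = −aGQ^*ψ = −1 is NOT a minimizer), **`eq464_inf`/`eq464_gaussian`** ((4.6.4): the infimum over φ of the scalar
form is ½⟨ψ, Δ_k(u_k)ψ⟩, and the φ-integral factorizes as e^{−½⟨ψ,Δ_kψ⟩}·∫e^{−½⟨φ,G_k^{−1}φ⟩}dφ by translation to ψ_k — *"the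
quadratic form which arises for the scalar field"*), **`psiK_isMinOn`** (p. 313: ψ_k = a_kG_kQ_k^*ψ is the η-lattice minimizer).
Carrier clauses (F6): the identification of D, Q with the lattice operators D_{u}, Q(u) of (2.6)/(4.6.3) (e.g. the V1 calculus
`Balaban1983to89.LatticeFieldCalculus.covDerivScalar`/`covSiteAvg`) is the instance's, exactly as in `BIJ85Eq461Proof`; S(u,φ) of
(3.24) enters as an arbitrary functional.  Axioms: the standard three.  No `def … : Prop` is introduced.
-/

open scoped RealInnerProductSpace
open MeasureTheory

namespace Literature.MathematicalPhysics.QuantumFieldTheory.BalabanImbrieJaffe1984to88.BIJ85ScalarForm464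

open BIJ85Eq461Proof BIJ85AppALemmas

noncomputable section

section Abstract

variable {Φ Ψ Φ₁ : Type*} [NormedAddCommGroup Φ] [InnerProductSpace ℝ Φ]
  [NormedAddCommGroup Ψ] [InnerProductSpace ℝ Ψ] [NormedAddCommGroup Φ₁] [InnerProductSpace ℝ Φ₁]

variable (D : Φ →ₗ[ℝ] Ψ) (Q : Φ →ₗ[ℝ] Φ₁) (a : ℝ)

/-! ## The objects: (3.24), (3.25), G⁻¹ of (3.26)/(4.6.2), φ_cl / ψ_k, Δ of (4.6.4) -/

/-- **(3.24)** p. 308 [PDF 10], verbatim: *"We expand S(u,φ) + ½a‖ψ − Q(u)φ‖² (3.24) to identify the quadratic terms in φ"* — the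
boson part of the first-step integrand: an action functional `S` of φ (the gauge field u fixed) plus the averaging Gaussian
½a‖ψ − Q(u)φ‖². [cite: BalabanImbrieJaffe1985, (3.24) p.308] -/
def form324 (S : Φ → ℝ) (ψ : Φ₁) (φ : Φ) : ℝ :=
  S φ + (1 / 2 : ℝ) * a * ‖ψ - Q φ‖ ^ 2

/-- **(3.25)** p. 308 [PDF 10], verbatim: *"Thus the leading terms in the Higgs action are ½a‖Q(u^{(1)})φ − ψ‖² + ½⟨φ, Δ_{u^{(1)}}φ⟩,
(3.25)"* — typed with the kinetic term as `½‖D_uφ‖² = ½⟨φ, D_u^*D_uφ⟩` ((4.6.3): −Δ_u = D_u^*D_u; see the module docstring on the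
printed sign of Δ); at step k (p. 313) the same form with a_k, Q_k(u_k), D_{u_k} is the exponent of (4.6.1) with the source ψ.
[cite: BalabanImbrieJaffe1985, (3.25) p.308] -/
def scalarForm (ψ : Φ₁) (φ : Φ) : ℝ :=
  (1 / 2 : ℝ) * a * ‖Q φ - ψ‖ ^ 2 + (1 / 2 : ℝ) * ‖D φ‖ ^ 2

variable {D Q a} in
/-- (3.24) → (3.25): when the φ-quadratic part of S(u,φ) is the kinetic term ½‖D_uφ‖², (3.24) IS the form (3.25) (the norm is
symmetric: ‖ψ − Qφ‖ = ‖Qφ − ψ‖). [cite: BalabanImbrieJaffe1985, (3.25) p.308] -/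
theorem form324_kinetic (ψ : Φ₁) (φ : Φ) :
    form324 Q a (fun φ => (1 / 2 : ℝ) * ‖D φ‖ ^ 2) ψ φ = scalarForm D Q a ψ φ := by
  simp only [form324, scalarForm, norm_sub_rev ψ (Q φ)]
  ring

variable [FiniteDimensional ℝ Φ] [FiniteDimensional ℝ Ψ] [FiniteDimensional ℝ Φ₁]

/-- **G⁻¹ of (3.26)/(4.6.2)**: the operator `T = D^*D + aQ^*Q` (= −Δ_u + aQ(u)^*Q(u)), verbatim (3.26): *"Define G = (−Δ_{u^{(1)}} +
aQ(u^{(1)})^*Q(u^{(1)}))^{−1}. (3.26)"*; G itself enters below as any right inverse of `T` (hypothesis `hG`, cf.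
`BIJ85Eq461Proof.exists_inverse`). [cite: BalabanImbrieJaffe1985, (3.26) p.308] -/
def opT : Φ →ₗ[ℝ] Φ :=
  D.adjoint ∘ₗ D + a • (Q.adjoint ∘ₗ Q)

/-- **φ_cl / ψ_k**: the configuration `aGQ^*ψ` — p. 313 verbatim *"the η-lattice minimizer ψ_k, where ψ_k = a_kG_k(u_k)Q_k^*(u_k)ψ"*;
this is (3.27) with the REPAIRED sign ((3.27) prints *"φ_cl = −aGQ(u′)^*ψ"*, refuted below: `eq327_asPrinted_refuted`).
[cite: BalabanImbrieJaffe1985, (3.27) p.308] -/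
def phiCl (G : Φ →ₗ[ℝ] Φ) (ψ : Φ₁) : Φ :=
  a • G (Q.adjoint ψ)

/-- **(4.6.4)** p. 313 [PDF 15], verbatim: *"Δ_k(u_k) = a_kI − a_k²Q_k(u_k)G_k(u_k)Q_k^*(u_k). (4.6.4)"* — as a linear operator on the
unit-lattice scalar fields (r15's ring-level `BIJ85Sect4Statements.deltaScalar` is this operator in `End Φ₁`: `deltaOp_eq_deltaScalar`);
at k = 1 it is the operator a[I − aQGQ^*] of (3.28). [cite: BalabanImbrieJaffe1985, (4.6.4) p.313] -/
def deltaOp (G : Φ →ₗ[ℝ] Φ) : Φ₁ →ₗ[ℝ] Φ₁ :=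
  a • LinearMap.id - a ^ 2 • (Q ∘ₗ G ∘ₗ Q.adjoint)

variable {D Q a}

/-- BRIDGE to the row's decl of record: `deltaOp` is r15's `BIJ85Sect4Statements.deltaScalar a_k Q G Q^*` read in the algebra
`End Φ₁` with the composite `QGQ^*` (the three factors act between different spaces, so the ring-level reading is through their
composite). [cite: BalabanImbrieJaffe1985, (4.6.4) p.313] -/
theorem deltaOp_eq_deltaScalar (G : Φ →ₗ[ℝ] Φ) :
    deltaOp Q a G = BIJ85Sect4Statements.deltaScalar a (1 : Module.End ℝ Φ₁) (Q ∘ₗ G ∘ₗ Q.adjoint) 1 := by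
  simp only [deltaOp, BIJ85Sect4Statements.deltaScalar, Algebra.algebraMap_eq_smul_one, one_mul, mul_one, smul_mul_assoc]
  rfl

/-- unfolding `T`: `⟨φ, Tφ⟩ = ‖Dφ‖² + a‖Qφ‖²` (p30's `BIJ85Eq461Proof.inner_op`). [cite: BalabanImbrieJaffe1985, (4.6.3) p.313] -/
theorem inner_opT (φ : Φ) : ⟪φ, opT D Q a φ⟫ = ‖D φ‖ ^ 2 + a * ‖Q φ‖ ^ 2 :=
  inner_op D Q a φ

/-- `T` is symmetric (p30's `BIJ85Eq461Proof.op_symm`). [cite: BalabanImbrieJaffe1985, (4.6.3) p.313] -/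
theorem opT_symm (x y : Φ) : ⟪opT D Q a x, y⟫ = ⟪x, opT D Q a y⟫ :=
  op_symm D Q a x y

/-! ## (3.25) as a quadratic form in φ; the critical point -/

/-- The form (3.25) expanded: `½a‖Qφ − ψ‖² + ½‖Dφ‖² = ½⟨φ, Tφ⟩ − ⟨φ, aQ^*ψ⟩ + ½a‖ψ‖²` (the shape `h(A) = ½‖αA + B‖²` of Appendix A
(A1), *"See Appendix A"*). [cite: BalabanImbrieJaffe1985, (3.25) p.308] -/
theorem scalarForm_eq (ψ : Φ₁) (φ : Φ) :
    scalarForm D Q a ψ φ = (1 / 2 : ℝ) * ⟪φ, opT D Q a φ⟫ - ⟪φ, a • Q.adjoint ψ⟫ + (1 / 2 : ℝ) * a * ‖ψ‖ ^ 2 := by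
  rw [scalarForm, inner_opT, real_inner_smul_right, LinearMap.adjoint_inner_right, @norm_sub_sq_real]
  ring

/-- `Tφ_cl = aQ^*ψ`: φ_cl = aGQ^*ψ solves the Euler–Lagrange equation of (3.25) (G a right inverse of T, `hG`).
[cite: BalabanImbrieJaffe1985, (3.27) p.308] -/
theorem opT_phiCl {G : Φ →ₗ[ℝ] Φ} (hG : ∀ φ, opT D Q a (G φ) = φ) (ψ : Φ₁) :
    opT D Q a (phiCl Q a G ψ) = a • Q.adjoint ψ := by
  rw [phiCl, map_smul, hG]

/-! ## (3.28): background and fluctuation parts -/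

/-- **(3.28)** p. 308 [PDF 10], verbatim: *"Writing φ = φ_cl + φ_fl, expand (3.24) into background and fluctuation parts, yielding
½⟨φ_fl, G^{−1}φ_fl⟩ + ½a⟨ψ, [I − aQGQ^*]ψ⟩. (3.28)"* — PROVED as an exact identity for the quadratic form (3.25) at φ = φ_cl + φ_fl,
φ_cl = aGQ^*ψ, G^{−1} = T = D^*D + aQ^*Q (completing the square, `BIJ85AppALemmas.complete_square`).
[cite: BalabanImbrieJaffe1985, (3.28) p.308] -/
theorem eq328 {G : Φ →ₗ[ℝ] Φ} (hG : ∀ φ, opT D Q a (G φ) = φ) (ψ : Φ₁) (χ : Φ) :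
    scalarForm D Q a ψ (phiCl Q a G ψ + χ)
      = (1 / 2 : ℝ) * ⟪χ, opT D Q a χ⟫
        + (1 / 2 : ℝ) * a * ⟪ψ, ((LinearMap.id : Φ₁ →ₗ[ℝ] Φ₁) - a • (Q ∘ₗ G ∘ₗ Q.adjoint)) ψ⟫ := by
  have hcs := complete_square (opT D Q a) (a • Q.adjoint ψ) (opT_symm (D := D) (Q := Q) (a := a)) (phiCl Q a G ψ)
    (opT_phiCl hG ψ) (phiCl Q a G ψ + χ)
  rw [scalarForm_eq, hcs, add_sub_cancel_left]
  have h1 : ⟪a • Q.adjoint ψ, phiCl Q a G ψ⟫ = a * (a * ⟪ψ, Q (G (Q.adjoint ψ))⟫) := by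
    rw [phiCl, real_inner_smul_left, real_inner_smul_right, LinearMap.adjoint_inner_left]
  have h2 : ⟪ψ, ((LinearMap.id : Φ₁ →ₗ[ℝ] Φ₁) - a • (Q ∘ₗ G ∘ₗ Q.adjoint)) ψ⟫
      = ‖ψ‖ ^ 2 - a * ⟪ψ, Q (G (Q.adjoint ψ))⟫ := by
    simp only [LinearMap.sub_apply, LinearMap.id_apply, LinearMap.smul_apply, LinearMap.coe_comp, Function.comp_apply,
      inner_sub_right, real_inner_smul_right, real_inner_self_eq_norm_sq]
  rw [h1, h2]
  ring

/-- The VALUE at the critical point: the form (3.25) at φ_cl equals `½⟨ψ, Δψ⟩`, Δ = aI − a²QGQ^* of (4.6.4) (= ½a⟨ψ,[I − aQGQ^*]ψ⟩,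
the background part of (3.28)). [cite: BalabanImbrieJaffe1985, (4.6.4) p.313] -/
theorem scalarForm_phiCl {G : Φ →ₗ[ℝ] Φ} (hG : ∀ φ, opT D Q a (G φ) = φ) (ψ : Φ₁) :
    scalarForm D Q a ψ (phiCl Q a G ψ) = (1 / 2 : ℝ) * ⟪ψ, deltaOp Q a G ψ⟫ := by
  have h := eq328 hG ψ 0
  rw [add_zero] at h
  rw [h, map_zero, inner_zero_right, mul_zero, zero_add, deltaOp]
  simp only [LinearMap.sub_apply, LinearMap.id_apply, LinearMap.smul_apply, LinearMap.coe_comp, Function.comp_apply,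
    inner_sub_right, real_inner_smul_right]
  ring

/-- The fluctuation part is non-negative for a ≥ 0: `⟨χ, Tχ⟩ = ‖Dχ‖² + a‖Qχ‖² ≥ 0`. [cite: BalabanImbrieJaffe1985, (3.28) p.308] -/
theorem inner_opT_nonneg (ha : 0 ≤ a) (χ : Φ) : 0 ≤ ⟪χ, opT D Q a χ⟫ := by
  rw [inner_opT]
  positivity

/-! ## (3.27) decided, and the p. 313 minimizer ψ_k -/

/-- **(3.27) with the sign of p. 313, PROVED**: for a ≥ 0 the configuration φ_cl = aGQ(u)^*ψ MINIMIZES the quadratic form (3.25)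
over all φ (verbatim (3.27): *"The quadratic form (3.25) is minimized by φ_cl = −aGQ(u′)^*ψ. (3.27) See Appendix A."* — the printed
minus sign is refuted below; p. 313 prints the same object with the plus sign, ψ_k = a_kG_kQ_k^*ψ).
[cite: BalabanImbrieJaffe1985, (3.27) p.308] -/
theorem isMinOn_phiCl {G : Φ →ₗ[ℝ] Φ} (hG : ∀ φ, opT D Q a (G φ) = φ) (ha : 0 ≤ a) (ψ : Φ₁) :
    IsMinOn (scalarForm D Q a ψ) Set.univ (phiCl Q a G ψ) := by
  rw [isMinOn_univ_iff]
  intro φ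
  have h := eq328 hG ψ (φ - phiCl Q a G ψ)
  rw [add_sub_cancel] at h
  have h0 := eq328 hG ψ 0
  rw [add_zero, map_zero, inner_zero_right, mul_zero, zero_add] at h0
  rw [h, h0]
  have := inner_opT_nonneg (D := D) (Q := Q) ha (φ - phiCl Q a G ψ)
  nlinarith

/-- **(4.6.4), the infimum**: for a ≥ 0 and every φ, `½⟨ψ, Δ_k(u_k)ψ⟩ ≤ ½a_k‖Q_k(u_k)φ − ψ‖² + ½‖D_{u_k}φ‖²`, with equality at
φ = ψ_k (`scalarForm_phiCl`) — *"The quadratic form which arises for the scalar field is ⟨ψ, Δ_k(u_k)ψ⟩"*.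
[cite: BalabanImbrieJaffe1985, (4.6.4) p.313] -/
theorem eq464_inf {G : Φ →ₗ[ℝ] Φ} (hG : ∀ φ, opT D Q a (G φ) = φ) (ha : 0 ≤ a) (ψ : Φ₁) (φ : Φ) :
    (1 / 2 : ℝ) * ⟪ψ, deltaOp Q a G ψ⟫ ≤ scalarForm D Q a ψ φ := by
  rw [← scalarForm_phiCl hG]
  exact (isMinOn_univ_iff.mp (isMinOn_phiCl hG ha ψ)) φ

/-- **p. 313, the η-lattice minimizer ψ_k**, verbatim: *"The scalar field action depends on the unit lattice field ψ through the
η-lattice minimizer ψ_k, where ψ_k = a_kG_k(u_k)Q_k^*(u_k)ψ."* — PROVED: ψ_k (`phiCl` at a_k, Q_k(u_k), G_k(u_k)) minimizes the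
step-k scalar form ½a_k‖Q_k(u_k)φ − ψ‖² + ½‖D_{u_k}φ‖² (a_k ≥ 0). [cite: BalabanImbrieJaffe1985, (4.6.4) p.313] -/
theorem psiK_isMinOn {G : Φ →ₗ[ℝ] Φ} (hG : ∀ φ, opT D Q a (G φ) = φ) (ha : 0 ≤ a) (ψ : Φ₁) :
    IsMinOn (scalarForm D Q a ψ) Set.univ (phiCl Q a G ψ) :=
  isMinOn_phiCl hG ha ψ

/-- UNIQUENESS of the minimizer under the convergence condition of (4.6.1) (p30's `hpos`: ‖Dφ‖² + a‖Qφ‖² > 0 for φ ≠ 0): any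
minimizer of the form (3.25) over all φ IS φ_cl = aGQ^*ψ (= ψ_k). [cite: BalabanImbrieJaffe1985, (3.27) p.308] -/
theorem eq_phiCl_of_isMinOn {G : Φ →ₗ[ℝ] Φ} (hG : ∀ φ, opT D Q a (G φ) = φ)
    (hpos : ∀ φ : Φ, φ ≠ 0 → 0 < ‖D φ‖ ^ 2 + a * ‖Q φ‖ ^ 2) {ψ : Φ₁} {φ : Φ}
    (hmin : IsMinOn (scalarForm D Q a ψ) Set.univ φ) : φ = phiCl Q a G ψ := by
  by_contra hne
  have hχ : φ - phiCl Q a G ψ ≠ 0 := sub_ne_zero.mpr hne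
  have h := eq328 hG ψ (φ - phiCl Q a G ψ)
  rw [add_sub_cancel] at h
  have h0 := eq328 hG ψ 0
  rw [add_zero, map_zero, inner_zero_right, mul_zero, zero_add] at h0
  have hle := (isMinOn_univ_iff.mp hmin) (phiCl Q a G ψ)
  have hp := hpos _ hχ
  rw [← inner_opT] at hp
  linarith

/-! ## (4.6.4) as a Gaussian integral: the form that arises after the φ-integration -/

variable [MeasurableSpace Φ] [BorelSpace Φ]

/-- **(4.6.4), Gaussian form** — *"The quadratic form which arises for the scalar field is ⟨ψ, Δ_k(u_k)ψ⟩"*: integrating out the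
η-lattice scalar field, `∫𝒟φ exp[−½a_k‖Q_k(u_k)φ − ψ‖² − ½‖D_{u_k}φ‖²] = exp(−½⟨ψ, Δ_k(u_k)ψ⟩) · ∫𝒟φ exp(−½⟨φ, G_k(u_k)^{−1}φ⟩)`,
by the translation φ = ψ_k + φ_fl of (3.28) and the translation invariance of 𝒟φ (the Lebesgue measure of the finite-dimensional
field space; no convergence hypothesis is needed for the identity). [cite: BalabanImbrieJaffe1985, (4.6.4) p.313] -/
theorem eq464_gaussian {G : Φ →ₗ[ℝ] Φ} (hG : ∀ φ, opT D Q a (G φ) = φ) (ψ : Φ₁) :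
    ∫ φ : Φ, Real.exp (-scalarForm D Q a ψ φ)
      = Real.exp (-((1 / 2 : ℝ) * ⟪ψ, deltaOp Q a G ψ⟫)) * ∫ φ : Φ, Real.exp (-((1 / 2 : ℝ) * ⟪φ, opT D Q a φ⟫)) := by
  have h0 := scalarForm_phiCl hG ψ
  have key : ∀ φ : Φ, -scalarForm D Q a ψ φ
      = -((1 / 2 : ℝ) * ⟪ψ, deltaOp Q a G ψ⟫)
        + -((1 / 2 : ℝ) * ⟪φ - phiCl Q a G ψ, opT D Q a (φ - phiCl Q a G ψ)⟫) := by
    intro φ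
    have h := eq328 hG ψ (φ - phiCl Q a G ψ)
    rw [add_sub_cancel] at h
    have h0' := eq328 hG ψ 0
    rw [add_zero, map_zero, inner_zero_right, mul_zero, zero_add] at h0'
    rw [h, ← h0', h0]
    ring
  simp_rw [key, Real.exp_add]
  rw [integral_const_mul, integral_sub_right_eq_self (fun φ : Φ => Real.exp (-((1 / 2 : ℝ) * ⟪φ, opT D Q a φ⟫))) (phiCl Q a G ψ)]

end Abstract

/-! ## (3.27) AS PRINTED is refuted -/

/-- **(3.27) AS PRINTED, REFUTED by a kernel witness.**  The print reads *"The quadratic form (3.25) is minimized by φ_cl =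
−aGQ(u′)^*ψ. (3.27)"*.  With the one-dimensional data Φ = Ψ = Φ₁ = ℝ, D = 0, Q = I, a = 1 (so T = G^{−1} = I, G = I) and ψ = 1, the
form (3.25) is ½|φ − 1|², whose minimizer is +1 = aGQ^*ψ, while the printed −aGQ^*ψ = −1 gives the value 2 > 0: the printed
configuration is not a minimizer.  (p. 313 prints the same object with the correct sign, ψ_k = a_kG_kQ_k^*ψ; `isMinOn_phiCl`.)
[cite: BalabanImbrieJaffe1985, (3.27) p.308] -/
theorem eq327_asPrinted_refuted :
    (∀ φ : ℝ, opT (0 : ℝ →ₗ[ℝ] ℝ) (LinearMap.id : ℝ →ₗ[ℝ] ℝ) 1 ((LinearMap.id : ℝ →ₗ[ℝ] ℝ) φ) = φ) ∧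
      ¬ IsMinOn (scalarForm (0 : ℝ →ₗ[ℝ] ℝ) (LinearMap.id : ℝ →ₗ[ℝ] ℝ) 1 (1 : ℝ)) Set.univ
          (-(phiCl (LinearMap.id : ℝ →ₗ[ℝ] ℝ) 1 (LinearMap.id : ℝ →ₗ[ℝ] ℝ) (1 : ℝ))) := by
  have hadj : (LinearMap.id : ℝ →ₗ[ℝ] ℝ).adjoint = LinearMap.id := LinearMap.adjoint_id
  refine ⟨fun φ => ?_, fun hmin => ?_⟩
  · simp [opT, hadj]
  · have h := (isMinOn_univ_iff.mp hmin) (1 : ℝ)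
    simp [scalarForm, phiCl, hadj] at h
    norm_num at h

end

end Literature.MathematicalPhysics.QuantumFieldTheory.BalabanImbrieJaffe1984to88.BIJ85ScalarForm464
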